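import Summits.RiemannHypothesis.RiemannHypothesis.Theses.EtaTailTrialBound
import HarnessLib

/-!
# Route EtaTailTrialBound (L15) — `Assembly` (item stmt-RiemannHypothesis-21601)

`EtaTailSecondMoment → LockingLayer → TrialVectorAssembly → IntegerScrew.ScrewFloorTrialBound` is the
type of the route's deciding theorem `Theses.EtaTailTrialBound.closes` (route file sha16 45035cefaf161455):
under RH, `TrialVectorAssembly` fed with the two cruxes yields, eventually in `M`, a non-zero trial vector
with `M · screwRayleigh M v ≤ 1/4 + (a′ + ε)/log M`, and `IntegerScrew.screwFloorTrialBound_of_trialVectors`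
turns trial vectors into the floor bound; without RH the leaf holds by
`IntegerScrew.screwFloorTrialBound_of_not_riemannHypothesis`. Port of the planner's `closes` body
(rh-idea-7 g0) against the route decls. CONDITIONAL bookkeeping: the cruxes `EtaTailSecondMoment`,
`LockingLayer` and the support `TrialVectorAssembly` stay OPEN — neither the leaf nor RH is proved by this;
nothing here bears on the truth of RH.
-/

-- D-0017: `Summit.RiemannHypothesis.RiemannHypothesis.…` duplicates the namespace BY DESIGN (single-problem summit).
set_option linter.dupNamespace false

namespace Summit.RiemannHypothesis.RiemannHypothesis.Theorems.EtaTailTrialBound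

open Summit.RiemannHypothesis.RiemannHypothesis.Theorems.IntegerScrew in
/-- **`Assembly` (item stmt-RiemannHypothesis-21601) holds**: case split on RH; under RH the trial vectors of
`TrialVectorAssembly` give the floor bound (`screwFloorTrialBound_of_trialVectors`), otherwise the leaf holds
vacuously (`screwFloorTrialBound_of_not_riemannHypothesis`). Same proof as the route's `closes`. -/
theorem assembly_proof :
    Summit.RiemannHypothesis.RiemannHypothesis.Theses.EtaTailTrialBound.Assembly := by
  intro h₁ h₂ h₃
  by_cases hRH : _root_.RiemannHypothesis
  · exact screwFloorTrialBound_of_trialVectors fun ε hε => (h₃ h₁ h₂ hRH ε hε).mono fun M hM _ => hM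
  · exact screwFloorTrialBound_of_not_riemannHypothesis hRH

end Summit.RiemannHypothesis.RiemannHypothesis.Theorems.EtaTailTrialBound
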